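import Summits.Langlands.Langlands.Theorems.MonodromyRankLadderJReaching
import HarnessLib

/-!
# `MonodromyRankLadder.GenericIffRankMaximal` (stmt-Langlands-27783), part III:
rank-maximal ⇒ generic

Setting as in parts I–II.  `generic_of_rankMax`: a rank-maximal degree `+1` endomorphism `t`
admits no non-zero degree `-1` endomorphism commuting with it.  Induction on `dim_K M` as in
`Literature…exists_graded_linearEquiv_conj`: for a simple type `S` with lowest degree `p` and
maximal occupied interval `[p, q]`, part II gives `e : S → gr p` with `t^{q-p} e ≠ 0`;
`exists_isCompl_stringSum` splits its string off, `M = Z ⊕ C`; rank-maximality passes to `t|_C`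
(extend a competitor by `t|_Z`, ranks add), so `t|_C` is generic by induction; a degree `-1` map
`f` commuting with `t` then maps `C` into `Z`, kills `e` (nothing of type `S` in degree `p - 1`)
hence `Z`, and `f|_C ≠ 0` would, pushed up by `t`, put a copy of `S` in degree `q + 1`.
lens-2 g26 node twin (decomp-langlands), 2026-08-31.
-/

set_option linter.dupNamespace false

namespace Summit.Langlands.Langlands.Theorems

namespace RankLadderJ

open Module Literature.RepresentationTheory.Semisimple

section Generic

variable {K : Type*} [Field K] {R : Type*} [Ring R] [Algebra K R]

/-- Ranks add over a decomposition `M = Z ⊕ C` preserved by `T`. -/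
theorem finrank_range_pow_eq_add {M : Type*} [AddCommGroup M] [Module K M] [Module R M]
    [IsScalarTower K R M] [FiniteDimensional K M] {Z C : Submodule R M} (hZC : IsCompl Z C)
    (T : M →ₗ[R] M) (TZ : Z →ₗ[R] Z) (TC : C →ₗ[R] C) (hTZ : ∀ z : Z, T z = TZ z)
    (hTC : ∀ y : C, T y = TC y) (k : ℕ) :
    finrank K (LinearMap.range (T ^ k)) =
      finrank K (LinearMap.range (TZ ^ k)) + finrank K (LinearMap.range (TC ^ k)) := by
  have hZk' : ∀ (j : ℕ) (z : Z), (T ^ j) z = (TZ ^ j) z := by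
    intro j
    induction j with
    | zero => intro z; simp
    | succ j ih => intro z; rw [pow_succ', pow_succ', Module.End.mul_apply,
        Module.End.mul_apply, ih, hTZ]
  have hCk' : ∀ (j : ℕ) (y : C), (T ^ j) y = (TC ^ j) y := by
    intro j
    induction j with
    | zero => intro y; simp
    | succ j ih => intro y; rw [pow_succ', pow_succ', Module.End.mul_apply,
        Module.End.mul_apply, ih, hTC]
  have hZk := hZk' k
  have hCk := hCk' k
  have hrange : LinearMap.range (T ^ k) =
      (LinearMap.range (TZ ^ k)).map Z.subtype ⊔ (LinearMap.range (TC ^ k)).map C.subtype := by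
    refine le_antisymm ?_ (sup_le ?_ ?_)
    · rintro _ ⟨x, rfl⟩
      obtain ⟨z, hz, y, hy, rfl⟩ := Submodule.mem_sup.mp
        ((hZC.sup_eq_top.symm ▸ Submodule.mem_top : x ∈ Z ⊔ C))
      rw [map_add]
      refine Submodule.mem_sup.mpr ⟨_, ⟨(TZ ^ k) ⟨z, hz⟩, ⟨_, rfl⟩, rfl⟩, _,
        ⟨(TC ^ k) ⟨y, hy⟩, ⟨_, rfl⟩, rfl⟩, ?_⟩
      rw [Submodule.subtype_apply, Submodule.subtype_apply, ← hZk, ← hCk]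
    · rintro _ ⟨_, ⟨z, rfl⟩, rfl⟩
      exact ⟨z, by rw [hZk]; rfl⟩
    · rintro _ ⟨_, ⟨y, rfl⟩, rfl⟩
      exact ⟨y, by rw [hCk]; rfl⟩
  have hdisj : Disjoint ((LinearMap.range (TZ ^ k)).map Z.subtype)
      ((LinearMap.range (TC ^ k)).map C.subtype) :=
    hZC.disjoint.mono (Submodule.map_subtype_le _ _) (Submodule.map_subtype_le _ _)
  rw [hrange, finrank_sup_eq_of_disjoint_R hdisj,
    ((Submodule.equivMapOfInjective Z.subtype Subtype.val_injective _).restrictScalars K).finrank_eq,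
    ((Submodule.equivMapOfInjective C.subtype Subtype.val_injective _).restrictScalars K).finrank_eq]

/-- Inductive form of `generic_of_rankMax` (induction on `dim_K M`). -/
theorem generic_of_rankMax_aux [Infinite K] (n : ℕ) :
    ∀ {M : Type*} [AddCommGroup M] [Module K M] [Module R M] [IsScalarTower K R M]
      [FiniteDimensional K M] [IsSemisimpleModule R M]
      (gr : ℕ → Submodule R M) (_ : iSupIndep gr) (_ : ⨆ k, gr k = ⊤)
      (Nb : ℕ) (_ : ∀ k, Nb ≤ k → gr k = ⊥)
      (t : M →ₗ[R] M) (_ : ∀ k, ∀ x ∈ gr k, t x ∈ gr (k + 1))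
      (_ : ∀ t' : M →ₗ[R] M, (∀ k, ∀ x ∈ gr k, t' x ∈ gr (k + 1)) →
        ∀ k, 1 ≤ k → finrank K (LinearMap.range (t' ^ k)) ≤ finrank K (LinearMap.range (t ^ k)))
      (_ : finrank K M ≤ n)
      (f : M →ₗ[R] M) (_ : ∀ x ∈ gr 0, f x = 0) (_ : ∀ k, ∀ x ∈ gr (k + 1), f x ∈ gr k)
      (_ : f ∘ₗ t = t ∘ₗ f), f = 0 := by
  induction n with
  | zero =>
    intro M _ _ _ _ _ _ gr hind hsup Nb hNb t ht hmax hdim f hf0 hf1 hft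
    have h0 : ∀ x : M, x = 0 := finrank_zero_iff_forall_zero.mp (Nat.le_zero.mp hdim)
    ext x
    rw [h0 x, map_zero, LinearMap.zero_apply]
  | succ n ih =>
    intro M _ _ _ _ _ _ gr hind hsup Nb hNb t ht hmax hdim f hf0 hf1 hft
    classical
    have hfpow : ∀ (j : ℕ) (x : M), f ((t ^ j) x) = (t ^ j) (f x) := by
      intro j
      induction j with
      | zero => intro x; simp
      | succ j ihj =>
        intro x
        rw [pow_succ', Module.End.mul_apply, Module.End.mul_apply, ← ihj]
        exact congr($hft ((t ^ j) x))
    by_cases hzero : ∀ k, gr k = ⊥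
    · ext x
      have hx : x ∈ ⨆ k, gr k := hsup ▸ Submodule.mem_top
      simp only [hzero, iSup_bot, Submodule.mem_bot] at hx
      rw [hx, map_zero, LinearMap.zero_apply]
    push Not at hzero
    obtain ⟨k₁, hk₁⟩ := hzero
    -- a simple type `S = m`, its lowest degree `p`, the top `q` of the occupied interval
    obtain ⟨m, hm, hmS⟩ := (IsSemisimpleModule.eq_bot_or_exists_simple_le (gr k₁)).resolve_left hk₁
    haveI := hmS
    have hnocc_iff : ∀ j, (∀ u : m →ₗ[R] M, (∀ s, u s ∈ gr j) → u = 0) ↔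
        ¬ ∃ u : m →ₗ[R] M, u ≠ 0 ∧ ∀ s, u s ∈ gr j := by
      intro j
      constructor
      · rintro h ⟨u, hu0, hu⟩; exact hu0 (h u hu)
      · intro h u hu; by_contra hne; exact h ⟨u, hne, hu⟩
    have hex_occ : ∃ j, ∃ u : m →ₗ[R] M, u ≠ 0 ∧ ∀ s, u s ∈ gr j := by
      refine ⟨k₁, m.subtype, ?_, fun s => hm s.2⟩
      intro h0
      haveI := IsSimpleModule.nontrivial R m
      obtain ⟨s, hs⟩ := exists_ne (0 : m)
      exact hs (Subtype.ext (congr($h0 s)))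
    set p := Nat.find hex_occ with hp
    have hp_occ : ∃ u : m →ₗ[R] M, u ≠ 0 ∧ ∀ s, u s ∈ gr p := Nat.find_spec hex_occ
    have hp_below : ∀ k, k + 1 = p → ∀ u : m →ₗ[R] M, (∀ s, u s ∈ gr k) → u = 0 := by
      intro k hk
      rw [hnocc_iff]
      exact Nat.find_min hex_occ (show k < p by omega)
    have hex_end : ∃ j, ¬ ∃ u : m →ₗ[R] M, u ≠ 0 ∧ ∀ s, u s ∈ gr (p + j + 1) := by
      refine ⟨Nb, ?_⟩
      rintro ⟨u, hu0, hu⟩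
      apply hu0; ext s
      have := hu s
      rw [hNb (p + Nb + 1) (by omega), Submodule.mem_bot] at this
      rw [this, LinearMap.zero_apply]
    set j₀ := Nat.find hex_end with hj₀
    have hq_end : ¬ ∃ u : m →ₗ[R] M, u ≠ 0 ∧ ∀ s, u s ∈ gr (p + j₀ + 1) := Nat.find_spec hex_end
    have hocc : ∀ k, p ≤ k → k ≤ p + j₀ → ∃ u : m →ₗ[R] M, u ≠ 0 ∧ ∀ s, u s ∈ gr k := by
      intro k hk1 hk2
      rcases Nat.eq_or_lt_of_le hk1 with h | h
      · rw [← h]; exact hp_occ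
      · have := Nat.find_min hex_end (show k - p - 1 < j₀ by omega)
        rw [not_not, show p + (k - p - 1) + 1 = k by omega] at this
        exact this
    set q := p + j₀ with hq
    -- a long string (part II) and its complement
    obtain ⟨e, he, hec⟩ := exists_comp_pow_ne_zero_of_rankMax (K := K) gr hind hsup t ht hmax
      p q (by omega) hocc
    set c := q - p with hc
    have hec1 : (t ^ (c + 1)) ∘ₗ e = 0 := by
      by_contra hne
      apply hq_end
      rw [show p + j₀ + 1 = q + 1 by omega]
      refine ⟨(t ^ (c + 1)) ∘ₗ e, hne, fun s => ?_⟩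
      have := pow_apply_mem_gr gr t ht (he s) (c + 1)
      rwa [show p + (c + 1) = q + 1 by omega] at this
    let Ψ : (Fin (c + 1) → m) →ₗ[R] M :=
      ∑ r : Fin (c + 1), ((t ^ (r : ℕ)) ∘ₗ e) ∘ₗ LinearMap.proj r
    have hΨ : ∀ s, Ψ s = ∑ r : Fin (c + 1), (t ^ (r : ℕ)) (e (s r)) := by
      intro s; simp [Ψ, LinearMap.sum_apply]
    have hΨ0 : ∀ s, Ψ s = ∑ r : Fin (c + 1), (t ^ (0 + (r : ℕ))) (e (s r)) := by
      simpa using hΨ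
    obtain ⟨hΨinj, C, hZC, hCt, hsplit⟩ :=
      exists_isCompl_stringSum gr hind hsup t ht e he hec hp_below Ψ hΨ
    set Z := LinearMap.range Ψ with hZdef
    have hZt : ∀ x ∈ Z, t x ∈ Z := by
      rintro _ ⟨s, rfl⟩
      rw [apply_stringSum_eq_stringSum_shift t e 0 (by simpa using hec1) Ψ hΨ0 s]
      exact ⟨_, rfl⟩
    have hdeg : ∀ k, ∀ x ∈ gr k, ∃ z ∈ Z, ∃ y ∈ C, y ∈ gr k ∧ x = z + y := by
      intro k x hx
      obtain ⟨r, s₀, y, hyC, hyk, -, rfl⟩ := hsplit k x hx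
      exact ⟨_, ⟨_, rfl⟩, y, hyC, hyk, rfl⟩
    set grC : ℕ → Submodule R C := fun k => (gr k).comap C.subtype with hgrC
    obtain ⟨hindC, hsupC⟩ := iSupIndep_comap_subtype_of_isCompl gr hind hsup Z C hZC hdeg
    have hNC : ∀ k, Nb ≤ k → grC k = ⊥ := by
      intro k hk
      simp only [hgrC, hNb k hk, Submodule.comap_bot, Submodule.ker_subtype]
    set tC : C →ₗ[R] C := t.restrict hCt with htC
    have htC1 : ∀ k, ∀ x ∈ grC k, tC x ∈ grC (k + 1) := fun k x hx => ht k x hx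
    set tZ : Z →ₗ[R] Z := t.restrict hZt with htZ
    -- homogeneous components of elements of `Z` and `C` stay in `Z` and `C`
    have hdegZ : ∀ k, ∀ x ∈ gr k, ∀ z ∈ Z, ∀ y ∈ C, x = z + y → z ∈ gr k ∧ y ∈ gr k := by
      intro k x hx z hz y hy hxzy
      obtain ⟨z', hz', y', hy', hy'k, rfl⟩ := hdeg k x hx
      have h1 : z - z' = y' - y := by
        rw [sub_eq_sub_iff_add_eq_add, add_comm y' z']; exact hxzy.symm
      have h2 : z - z' ∈ Z ⊓ C := ⟨sub_mem hz hz', h1 ▸ sub_mem hy' hy⟩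
      rw [hZC.inf_eq_bot, Submodule.mem_bot, sub_eq_zero] at h2
      have h3 : y = y' := by
        have := hxzy; rw [h2, add_right_inj] at this; exact this.symm
      refine ⟨?_, h3 ▸ hy'k⟩
      rw [h2]
      have : z' + y' - y' ∈ gr k := sub_mem hx hy'k
      rwa [add_sub_cancel_right] at this
    -- rank-maximality of `t|_C`
    have hmaxC : ∀ t'' : C →ₗ[R] C, (∀ k, ∀ x ∈ grC k, t'' x ∈ grC (k + 1)) →
        ∀ k, 1 ≤ k → finrank K (LinearMap.range (t'' ^ k)) ≤
          finrank K (LinearMap.range (tC ^ k)) := by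
      intro t'' ht'' k hk
      set πZ : M →ₗ[R] Z := Submodule.projectionOnto Z C hZC with hπZ
      set πC : M →ₗ[R] C := Submodule.projectionOnto C Z hZC.symm with hπC
      set t' : M →ₗ[R] M := Z.subtype ∘ₗ tZ ∘ₗ πZ + C.subtype ∘ₗ t'' ∘ₗ πC with ht'def
      have ht'Z : ∀ z : Z, t' z = tZ z := by
        intro z
        simp only [ht'def, LinearMap.add_apply, LinearMap.comp_apply, Submodule.subtype_apply,
          hπZ, hπC, Submodule.projectionOnto_apply_left,
          (Submodule.projectionOnto_apply_eq_zero_iff hZC.symm).mpr z.2, map_zero, add_zero]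
      have ht'C : ∀ y : C, t' y = t'' y := by
        intro y
        simp only [ht'def, LinearMap.add_apply, LinearMap.comp_apply, Submodule.subtype_apply,
          hπZ, hπC, Submodule.projectionOnto_apply_left,
          (Submodule.projectionOnto_apply_eq_zero_iff hZC).mpr y.2, map_zero, zero_add]
      have ht'deg : ∀ k, ∀ x ∈ gr k, t' x ∈ gr (k + 1) := by
        intro k x hx
        obtain ⟨z, hz, y, hy, hyk, rfl⟩ := hdeg k x hx
        have hzk : z ∈ gr k := (hdegZ k _ hx z hz y hy rfl).1
        rw [map_add, show z = ((⟨z, hz⟩ : Z) : M) from rfl, ht'Z,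
          show y = ((⟨y, hy⟩ : C) : M) from rfl, ht'C]
        refine add_mem ?_ (ht'' k ⟨y, hy⟩ hyk)
        exact ht k z hzk
      have h1 := finrank_range_pow_eq_add (K := K) hZC t' tZ t'' ht'Z ht'C k
      have h2 := finrank_range_pow_eq_add (K := K) hZC t tZ tC (fun z => rfl) (fun y => rfl) k
      have h3 := hmax t' ht'deg k hk
      omega
    -- induction hypothesis: `t|_C` is generic
    haveI : FiniteDimensional K C := finite_of_submodule K C
    have hdimC : finrank K C ≤ n := by
      have h1 := finrank_add_finrank_of_isCompl K hZC
      haveI := finite_of_submodule K Z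
      haveI : Nontrivial Z := by
        rw [Submodule.nontrivial_iff_ne_bot]
        intro hZ0
        apply hec
        have he0 : e = 0 := by
          ext s
          have hmem : Ψ (Pi.single 0 s) ∈ Z := ⟨_, rfl⟩
          rw [hZ0, Submodule.mem_bot, stringSum_single t e 0 Ψ hΨ0 0 s] at hmem
          simpa using hmem
        rw [he0, LinearMap.comp_zero]
      have h2 : 0 < finrank K Z := Module.finrank_pos
      omega
    have hgenC := ih grC hindC hsupC Nb hNC tC htC1 hmaxC hdimC
    -- (i) the `C`-block of `f` vanishes: `f (C) ⊆ Z`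
    set πC : M →ₗ[R] C := Submodule.projectionOnto C Z hZC.symm with hπC
    have hπCZ : ∀ z ∈ Z, πC z = 0 := fun z hz =>
      (Submodule.projectionOnto_apply_eq_zero_iff hZC.symm).mpr hz
    have hπCC : ∀ y : C, πC y = y := fun y => Submodule.projectionOnto_apply_left hZC.symm y
    have hπCt : ∀ x : M, πC (t x) = tC (πC x) := by
      intro x
      obtain ⟨z, hz, y, hy, rfl⟩ := Submodule.mem_sup.mp
        ((hZC.sup_eq_top.symm ▸ Submodule.mem_top : x ∈ Z ⊔ C))
      rw [map_add, map_add, map_add, hπCZ z hz, hπCZ _ (hZt z hz), zero_add, zero_add,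
        show y = ((⟨y, hy⟩ : C) : M) from rfl, hπCC,
        show t ((⟨y, hy⟩ : C) : M) = ((tC ⟨y, hy⟩ : C) : M) from rfl, hπCC]
    set fC : C →ₗ[R] C := πC ∘ₗ f ∘ₗ C.subtype with hfC
    have hfC0 : fC = 0 := by
      refine hgenC fC (fun x hx => ?_) (fun k x hx => ?_) ?_
      · simp only [hfC, LinearMap.comp_apply, Submodule.subtype_apply]
        have hfx : f x = 0 := hf0 _ hx
        rw [hfx, map_zero]
      · simp only [hfC, LinearMap.comp_apply, Submodule.subtype_apply]
        have hfx : f x ∈ gr k := hf1 k _ hx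
        obtain ⟨z, hz, y, hy, hyk, hfxy⟩ := hdeg k _ hfx
        rw [hfxy, map_add, hπCZ z hz, zero_add, show y = ((⟨y, hy⟩ : C) : M) from rfl, hπCC]
        exact hyk
      · refine LinearMap.ext fun x => ?_
        simp only [hfC, LinearMap.comp_apply, Submodule.subtype_apply]
        rw [show ((tC x : C) : M) = t x from rfl, show f (t x) = t (f x) from congr($hft x),
          hπCt]
    have hfCZ : ∀ y ∈ C, f y ∈ Z := by
      intro y hy
      have h1 : πC (f y) = 0 := by
        have := congr($hfC0 ⟨y, hy⟩)
        simpa [hfC] using this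
      exact (Submodule.projectionOnto_apply_eq_zero_iff hZC.symm).mp h1
    -- (ii) `f` kills `e`, hence `Z`
    have hfe : ∀ s, f (e s) = 0 := by
      rcases Nat.eq_zero_or_pos p with hp0 | hp0
      · exact fun s => hf0 _ (hp0 ▸ he s)
      · obtain ⟨k, hk⟩ : ∃ k, k + 1 = p := ⟨p - 1, by omega⟩
        have := hp_below k hk (f ∘ₗ e) fun s => hf1 k _ (hk ▸ he s)
        exact fun s => congr($this s)
    have hfZ : ∀ z ∈ Z, f z = 0 := by
      rintro _ ⟨s, rfl⟩
      rw [hΨ, map_sum]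
      exact Finset.sum_eq_zero fun r _ => by rw [hfpow, hfe, map_zero]
    -- (iii) `f` kills `C`: otherwise a copy of `S` appears in degree `q + 1`
    have hCpow : ∀ (j : ℕ), ∀ y ∈ C, (t ^ j) y ∈ C := by
      intro j
      induction j with
      | zero => intro y hy; simpa using hy
      | succ j ihj => intro y hy; rw [pow_succ', Module.End.mul_apply]; exact hCt _ (ihj y hy)
    have hfC : ∀ y ∈ C, f y = 0 := by
      by_contra hcon
      push Not at hcon
      -- a homogeneous `y ∈ C ∩ gr (k' + 1)` with `f y ≠ 0`
      have hex : ∃ k, ∃ y ∈ C, y ∈ gr k ∧ f y ≠ 0 := by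
        by_contra hall
        push Not at hall
        obtain ⟨y, hyC, hfy⟩ := hcon
        apply hfy
        have hy : (⟨y, hyC⟩ : C) ∈ ⨆ k, grC k := hsupC ▸ Submodule.mem_top
        have : ∀ w : C, w ∈ ⨆ k, grC k → f w = 0 := fun w hw => by
          refine Submodule.iSup_induction _ (motive := fun w : C => f w = 0) hw ?_ (map_zero f) ?_
          · intro k w hw; exact hall k w w.2 hw
          · intro a b ha hb; rw [Submodule.coe_add, map_add, ha, hb, add_zero]
        exact this _ hy
      obtain ⟨k, y, hyC, hyk, hfy⟩ := hex
      obtain ⟨k', rfl⟩ : ∃ k', k = k' + 1 := by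
        rcases Nat.eq_zero_or_pos k with h | h
        · subst h; exact absurd (hf0 y hyk) hfy
        · exact ⟨k - 1, by omega⟩
      -- `f y = t ^ r (e s₀)` with `s₀ ≠ 0`, `p + r = k'`
      obtain ⟨r, s₀, y', hy'C, -, hpr, hfy_eq⟩ := hsplit k' (f y) (hf1 k' y hyk)
      have hy'0 : y' = 0 := by
        have h1 : y' ∈ Z := by
          have : y' = f y - Ψ (Pi.single r s₀) := by rw [hfy_eq, add_sub_cancel_left]
          rw [this]
          exact sub_mem (hfCZ y hyC) ⟨_, rfl⟩
        have h2 : y' ∈ Z ⊓ C := ⟨h1, hy'C⟩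
        rwa [hZC.inf_eq_bot, Submodule.mem_bot] at h2
      rw [hy'0, add_zero, stringSum_single t e 0 Ψ hΨ0 r s₀, zero_add] at hfy_eq
      have hs₀ : s₀ ≠ 0 := by
        rintro rfl; apply hfy; rw [hfy_eq, map_zero, map_zero]
      have hprk := hpr hs₀
      have hr : (r : ℕ) ≤ c := Nat.lt_succ_iff.mp r.2
      -- push to the top of the string
      set y₁ : M := (t ^ (c - r)) y with hy₁
      have hy₁C : y₁ ∈ C := hCpow _ y hyC
      have hy₁deg : y₁ ∈ gr (q + 1) := by
        have := pow_apply_mem_gr gr t ht hyk (c - r)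
        rwa [show k' + 1 + (c - (r : ℕ)) = q + 1 by omega] at this
      have hfy₁ : f y₁ = (t ^ c) (e s₀) := by
        rw [hy₁, hfpow, hfy_eq, ← Module.End.mul_apply, ← pow_add, Nat.sub_add_cancel hr]
      have hinj : Function.Injective ((t ^ c) ∘ₗ e) :=
        (LinearMap.injective_or_eq_zero _).resolve_right hec
      have hfy₁ne : f y₁ ≠ 0 := by
        rw [hfy₁]
        intro h0
        apply hs₀
        apply hinj
        rw [LinearMap.comp_apply, h0, map_zero]
      -- a retraction of `t ^ c ∘ e` and the induced map `C ∩ gr (q + 1) → S`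
      obtain ⟨lam, hlam, -⟩ := exists_retraction ((t ^ c) ∘ₗ e) hinj ⊥ disjoint_bot_right
      set D : Submodule R M := C ⊓ gr (q + 1) with hD
      set φ : D →ₗ[R] m := lam ∘ₗ f ∘ₗ D.subtype with hφ
      have hφy₁ : φ ⟨y₁, hy₁C, hy₁deg⟩ = s₀ := by
        simp only [hφ, LinearMap.comp_apply, Submodule.subtype_apply, hfy₁]
        exact hlam s₀
      have hφsurj : Function.Surjective φ := by
        refine (LinearMap.surjective_or_eq_zero φ).resolve_right fun h0 => hs₀ ?_
        rw [← hφy₁, h0, LinearMap.zero_apply]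
      obtain ⟨h, hh⟩ := IsSemisimpleModule.lifting_property φ hφsurj (LinearMap.id : m →ₗ[R] m)
      apply hq_end
      rw [show p + j₀ + 1 = q + 1 by omega]
      refine ⟨D.subtype ∘ₗ h, fun h0 => hs₀ ?_, fun s => (h s).2.2⟩
      have : h = 0 := by
        ext s
        exact congr($h0 s)
      have := congr($hh s₀)
      rw [‹h = 0›, LinearMap.comp_zero, LinearMap.zero_apply, LinearMap.id_apply] at this
      exact this.symm
    -- conclusion
    ext x
    obtain ⟨z, hz, y, hy, rfl⟩ := Submodule.mem_sup.mp
      ((hZC.sup_eq_top.symm ▸ Submodule.mem_top : x ∈ Z ⊔ C))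
    rw [map_add, hfZ z hz, hfC y hy, add_zero, LinearMap.zero_apply]

/-- **Rank-maximal ⇒ generic.**  In a graded finite-dimensional semisimple module over a ring
containing an infinite field `K`, a degree `+1` endomorphism `t` with `rank (t' ^ k) ≤ rank (t ^ k)`
for all degree `+1` endomorphisms `t'` and all `k ≥ 1` admits no non-zero degree `-1`
endomorphism commuting with it. [folklore; cf. Vogan 1993, doi:10.1090/conm/145/1216197,
Prop. 4.5; Abeasis–Del Fra–Kraft 1981, doi:10.1007/bf01679706] -/
theorem generic_of_rankMax [Infinite K] {M : Type*} [AddCommGroup M] [Module K M] [Module R M]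
    [IsScalarTower K R M] [FiniteDimensional K M] [IsSemisimpleModule R M]
    (gr : ℕ → Submodule R M) (hind : iSupIndep gr) (hsup : ⨆ k, gr k = ⊤)
    (Nb : ℕ) (hNb : ∀ k, Nb ≤ k → gr k = ⊥)
    (t : M →ₗ[R] M) (ht : ∀ k, ∀ x ∈ gr k, t x ∈ gr (k + 1))
    (hmax : ∀ t' : M →ₗ[R] M, (∀ k, ∀ x ∈ gr k, t' x ∈ gr (k + 1)) →
      ∀ k, 1 ≤ k → finrank K (LinearMap.range (t' ^ k)) ≤ finrank K (LinearMap.range (t ^ k)))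
    (f : M →ₗ[R] M) (hf0 : ∀ x ∈ gr 0, f x = 0) (hf1 : ∀ k, ∀ x ∈ gr (k + 1), f x ∈ gr k)
    (hft : f ∘ₗ t = t ∘ₗ f) : f = 0 :=
  generic_of_rankMax_aux (K := K) (finrank K M) gr hind hsup Nb hNb t ht hmax le_rfl f hf0 hf1 hft

end Generic

end RankLadderJ

end Summit.Langlands.Langlands.Theorems
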